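import Literature.AlgebraicGeometry.AbelianSchemes.AbelianSchemeOverZariskiGluingPolarizationOfDualPairs
import Literature.AlgebraicGeometry.AbelianSchemes.AbelianSchemeOverHomNoetherianAnyBase
import HarnessLib

/-!
# The dual transport is a homomorphism over ANY locally Noetherian base (no connectedness): the group-scheme clauses of
# ★ `AbelianSchemeDualTransportNoetherian`, ★ FILE A `AbelianSchemeDualTransportOfBaseChange` and ★ FILE B
# `AbelianSchemeOverZariskiGluingPolarizationOfDualPairs` with `[PreconnectedSpace]` REMOVED

Topic `AlgebraicGeometry/AbelianSchemes`; namespaces `…AbelianSchemeOver.DualPair` and `…AbelianSchemeOver.ZariskiGluingDatum`.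
Cell hodgecm-mathlib (D-0151), hand (h7)(D-F3) sequel (the residual named in FILE B's report: «the connectedness binder
on charts drops the minute ★ `isMonHom_of_one_comp_of_isLocallyNoetherian_base` serves» — it does, ★ p761725
`AbelianSchemeOverHomNoetherianAnyBase`, [MumfordFogartyKirwan1994, Cor. 6.4] AS PRINTED: any locally Noetherian base).
THEOREMS ONLY (no def, no structure, no instance, no notation, no `sorry`); the three files above stay byte-identical,
this file re-derives their group-scheme heads from the connectedness-free Cor. 6.4:

* §1 `DualPair.isMonHom_hatTransportOver_of_isLocallyNoetherian_base`, `hat_isBaseChangeVia_id_hatTransport_of_isLocallyNoetherian_base`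
  — ★ p759971's two heads without `[PreconnectedSpace S]`;
* §2 `DualPair.hat_isBaseChangeVia_hatTransportOfBaseChange_of_isLocallyNoetherian_base` — FILE A's group-scheme clause
  for the dual transport along a base-change square, `S'` locally Noetherian only;
* §3 `ZariskiGluingDatum.PolarizationChartDatum.hĜ_of_isLocallyNoetherian_base` — FILE B's discharge of `hĜ` over locally
  Noetherian charts (no connectedness), and `hĜ_of_isLocallyNoetherian_glued` — the same from `[IsLocallyNoetherian S]`
  alone (open subschemes of a locally Noetherian scheme are locally Noetherian, Mathlib
  `isLocallyNoetherian_of_isOpenImmersion`), so that `𝔔.toPolarizationDatum D₀ (𝔔.hĜ_of_isLocallyNoetherian_glued D₀ unit₀ unit)`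
  is the `PolarizationDatum` over any locally Noetherian glued base.

HC_CM is proved only modulo the printed citations until rung 0 closes; this file discharges none of them.

## References
* [MumfordFogartyKirwan1994] D. Mumford, J. Fogarty, F. Kirwan, *Geometric Invariant Theory*, 3rd ed. (1994), Ch. 6 §1
  Cor. 6.4 (p. 117), Cor. 6.8 (p. 118); Ch. 7 §2 Def. 7.2 (p. 129), Def. 7.3 (p. 129).
* [MilneAV2008] J. S. Milne, *Abelian Varieties* (v2.00, 2008), I §8 pp. 36–37.
-/

universe u

open CategoryTheory CategoryTheory.Limits AlgebraicGeometry MonoidalCategory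

noncomputable section

namespace Literature.AlgebraicGeometry.AbelianSchemes

namespace AbelianSchemeOver

open scoped MonObj

/-! ### §1 The dual transport along an isomorphism, over any locally Noetherian base -/

namespace DualPair

variable {S : Scheme.{u}} {A A' : AbelianSchemeOver S} (D : A.DualPair) (D' : A'.DualPair)
  (e : A'.X ≅ A.X) [IsMonHom e.hom]

/-- **`Ĥ_e` IS A HOMOMORPHISM over ANY locally Noetherian base** ([MumfordFogartyKirwan1994] Cor. 6.4 as printed, ★
`isMonHom_of_one_comp_of_isLocallyNoetherian_base`: no connectedness, no reducedness) — from `ε_{Â'} ≫ Ĥ_e = ε_Â` (★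
`one_comp_hatTransportOver` under the unit hypotheses). [cite: MumfordFogartyKirwan1994, Ch. 6 §1 Corollary 6.4 (p. 117)]
[cite: MilneAV2008, I §8 pp. 36–37] -/
theorem isMonHom_hatTransportOver_of_isLocallyNoetherian_base [IsLocallyNoetherian S]
    (hD : Nonempty ((Scheme.Modules.pullback (unitHatSlice D)).obj D.P ≅ SheafOfModules.unit _))
    (hD' : Nonempty ((Scheme.Modules.pullback (unitHatSlice D')).obj D'.P ≅ SheafOfModules.unit _)) :
    IsMonHom (hatTransportOver D D' e) :=
  isMonHom_of_one_comp_of_isLocallyNoetherian_base (A := D'.hat) (B := D.hat) (hatTransportOver D D' e)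
    (one_comp_hatTransportOver D D' e hD hD')

/-- **Clause (ii) of [MFK94] Def. 7.3 along `𝟙 S` for `(e, Ĥ_e)` over ANY locally Noetherian base**: `Â'` is the base change
of `Â` along `𝟙 S` via `Ĥ_e` AS GROUP SCHEMES (★ `isIso_hatTransportOver` + §1 + ★ `isBaseChangeVia_id_of_isMonHom`).
[cite: MumfordFogartyKirwan1994, Ch. 7 §2 Definition 7.3 (p. 129)] [cite: MilneAV2008, I §8 pp. 36–37] -/
theorem hat_isBaseChangeVia_id_hatTransport_of_isLocallyNoetherian_base [IsLocallyNoetherian S]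
    (e' : A.X ≅ A'.X) [IsMonHom e'.hom] (he' : e'.hom = e.inv)
    (hD : Nonempty ((Scheme.Modules.pullback (unitHatSlice D)).obj D.P ≅ SheafOfModules.unit _))
    (hD' : Nonempty ((Scheme.Modules.pullback (unitHatSlice D')).obj D'.P ≅ SheafOfModules.unit _)) :
    D'.hat.IsBaseChangeVia D.hat (𝟙 S) (hatTransport D D' e) := by
  haveI := isIso_hatTransportOver D D' e e' he'
  haveI := isMonHom_hatTransportOver_of_isLocallyNoetherian_base D D' e hD hD'
  exact isBaseChangeVia_id_of_isMonHom D'.hat D.hat (hatTransportOver D D' e)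

end DualPair

/-! ### §2 The dual transport along a base-change square, `S'` locally Noetherian only -/

namespace DualPair

variable {S S' : Scheme.{u}} {A : AbelianSchemeOver S} {A' : AbelianSchemeOver S'} {g : S' ⟶ S}
  {G : A'.X.left ⟶ A.X.left} (D : A.DualPair) (D' : A'.DualPair) (h : A'.IsBaseChangeVia A g G)

/-- **FILE A's group-scheme clause without connectedness**: over a locally Noetherian `S'`, under the unit hypotheses,
`Ĝ = hatTransportOfBaseChange D D' h` exhibits `Â'` as the base change of `Â` along `g` AS GROUP SCHEMES (§1 for `Ĥ`, ★
`baseChange_isBaseChangeVia` for `pr₁`, ★ `IsBaseChangeVia.trans`) — [MumfordFogartyKirwan1994] Cor. 6.8's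
«`(X ×_S T)^ = X̂ ×_S T`». [cite: MumfordFogartyKirwan1994, Ch. 6 §1 Cor. 6.8 (p. 118) and Corollary 6.4 (p. 117)]
[cite: MilneAV2008, I §8 pp. 36–37] -/
theorem hat_isBaseChangeVia_hatTransportOfBaseChange_of_isLocallyNoetherian_base [IsLocallyNoetherian S']
    (hD : Nonempty ((Scheme.Modules.pullback (unitHatSlice D)).obj D.P ≅ SheafOfModules.unit _))
    (hD' : Nonempty ((Scheme.Modules.pullback (unitHatSlice D')).obj D'.P ≅ SheafOfModules.unit _)) :
    D'.hat.IsBaseChangeVia D.hat g (hatTransportOfBaseChange D D' h) := by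
  haveI := h.isMonHom_isoBaseChange_hom
  haveI := h.isMonHom_isoBaseChange_symm_hom
  have h₁ : D'.hat.IsBaseChangeVia (D.baseChange g).hat (𝟙 S') (hatLift D D' h) :=
    hat_isBaseChangeVia_id_hatTransport_of_isLocallyNoetherian_base (D.baseChange g) D' h.isoBaseChange
      h.isoBaseChange.symm rfl (nonempty_unitHatSlice_baseChange_iso D hD) hD'
  have h₂ : D'.hat.IsBaseChangeVia D.hat (𝟙 S' ≫ g) (hatTransportOfBaseChange D D' h) :=
    h₁.trans (D.hat.baseChange_isBaseChangeVia g)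
  exact (congrArg (fun x => D'.hat.IsBaseChangeVia D.hat x (hatTransportOfBaseChange D D' h))
    (Category.id_comp g)).mp h₂

end DualPair

/-! ### §3 The `hĜ` clauses of a `PolarizationChartDatum` over locally Noetherian charts / a locally Noetherian base -/

namespace ZariskiGluingDatum

namespace PolarizationChartDatum

variable {S : Scheme.{u}} {𝔇 : ZariskiGluingDatum S} (𝔔 : PolarizationChartDatum 𝔇) (D₀ : 𝔇.abelianScheme.DualPair)

/-- **FILE B's `hĜ` over locally Noetherian charts, no connectedness** (§2). [cite: MumfordFogartyKirwan1994, Ch. 6 §1 Corollary 6.4 (p. 117) and Cor. 6.8 (p. 118)]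
[cite: MilneAV2008, I §8 pp. 36–37] -/
theorem hĜ_of_isLocallyNoetherian_base [∀ i, IsLocallyNoetherian (𝔇.𝒰.X i)]
    (unit₀ : Nonempty ((Scheme.Modules.pullback (DualPair.unitHatSlice D₀)).obj D₀.P ≅ SheafOfModules.unit _))
    (unit : ∀ i, Nonempty ((Scheme.Modules.pullback (DualPair.unitHatSlice (𝔔.Dc i))).obj (𝔔.Dc i).P ≅
      SheafOfModules.unit _)) (i : 𝔇.𝒰.I₀) :
    (𝔔.Dc i).hat.IsBaseChangeVia D₀.hat (𝔇.𝒰.f i) (𝔔.Ĝ D₀ i) :=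
  DualPair.hat_isBaseChangeVia_hatTransportOfBaseChange_of_isLocallyNoetherian_base D₀ (𝔔.Dc i)
    (𝔇.isBaseChangeVia_abelianScheme i) unit₀ (unit i)

/-- **FILE B's `hĜ` over a locally Noetherian BASE `S`**: the charts `Uᵢ ↪ S` are open subschemes, hence locally
Noetherian (Mathlib `isLocallyNoetherian_of_isOpenImmersion`). [cite: MumfordFogartyKirwan1994, Ch. 6 §1 Corollary 6.4 (p. 117) and Cor. 6.8 (p. 118)]
[cite: MilneAV2008, I §8 pp. 36–37] -/
theorem hĜ_of_isLocallyNoetherian_glued [IsLocallyNoetherian S]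
    (unit₀ : Nonempty ((Scheme.Modules.pullback (DualPair.unitHatSlice D₀)).obj D₀.P ≅ SheafOfModules.unit _))
    (unit : ∀ i, Nonempty ((Scheme.Modules.pullback (DualPair.unitHatSlice (𝔔.Dc i))).obj (𝔔.Dc i).P ≅
      SheafOfModules.unit _)) (i : 𝔇.𝒰.I₀) :
    (𝔔.Dc i).hat.IsBaseChangeVia D₀.hat (𝔇.𝒰.f i) (𝔔.Ĝ D₀ i) :=
  haveI : ∀ j, IsLocallyNoetherian (𝔇.𝒰.X j) := fun j => isLocallyNoetherian_of_isOpenImmersion (𝔇.𝒰.f j)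
  𝔔.hĜ_of_isLocallyNoetherian_base D₀ unit₀ unit i

/-- **The chart clause of the glued polarisation over a locally Noetherian base** (FILE B `pol_lam_left_comp_Ĝ` on the
connectedness-free `hĜ`): `λᵢ ≫ Ĝᵢ = χᵢ ≫ λ`. [cite: MumfordFogartyKirwan1994, Ch. 7 §2 Definition 7.2 (p. 129)] -/
theorem pol_lam_left_comp_Ĝ_of_isLocallyNoetherian_glued [IsLocallyNoetherian S]
    (unit₀ : Nonempty ((Scheme.Modules.pullback (DualPair.unitHatSlice D₀)).obj D₀.P ≅ SheafOfModules.unit _))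
    (unit : ∀ i, Nonempty ((Scheme.Modules.pullback (DualPair.unitHatSlice (𝔔.Dc i))).obj (𝔔.Dc i).P ≅
      SheafOfModules.unit _)) (i : 𝔇.𝒰.I₀) :
    (𝔔.pol i).lam.left ≫ 𝔔.Ĝ D₀ i =
      𝔇.χ i ≫ (𝔔.toPolarizationDatum D₀ (𝔔.hĜ_of_isLocallyNoetherian_glued D₀ unit₀ unit)).polarization.lam.left :=
  𝔔.pol_lam_left_comp_Ĝ D₀ (𝔔.hĜ_of_isLocallyNoetherian_glued D₀ unit₀ unit) i

end PolarizationChartDatum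

end ZariskiGluingDatum

end AbelianSchemeOver

end Literature.AlgebraicGeometry.AbelianSchemes

end
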